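import Literature.NumberTheory.PAdicHodge.AinfWeierstrassTateModuleMatching
import Literature.NumberTheory.EllipticCurves.TorsionPointsAlgebraic
import Literature.NumberTheory.EllipticCurves.GaloisAction
import Literature.NumberTheory.EllipticCurves.ComplexMultiplicationDeuringReductionMapProofs
import HarnessLib

/-!
# `T_p E(F̄) ≅ T_pŴ(𝒪_{ℂ_F})` as `Γ_F`-modules when `E[p^∞](ℂ_F) ⊂ E₁(ℂ_F)` (the matching of the geometric Tate module with the Tate
# module of the formal group, `W/ℤ`, `F` a `p`-adic field)

Topic `Literature/NumberTheory/PAdicHodge`; final file of the matching lane (M) of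
`Summits/…/Cruxes/StarredOptimalManinUnitFiveSeven/Lines/kato-lever-hDR-M-matching.md`. For an integral Weierstrass equation `W/ℤ` with
`Δ ≠ 0`, `F` a `p`-adic field, `E_F = W ⊗ F` (`curveF W`), `E(F̄) = geomPoints (curveF W)` with its `Γ_F`-action (tree `GaloisAction`):

* `geomToC W : E(F̄) →+ E(ℂ_F)` along `F̄ → ℂ_F` (`algClosureToC`), injective, **Γ_F-equivariant** (`geomToC_smul`: with the coordinatewise
  action `galPointC` on `E(ℂ_F)`), and **bijective on Tate modules** (`tateGeomEquivC`, torsion points are algebraic,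
  `TorsionPointsAlgebraic`);
* **`tateGeomEquivTatePt : T_p E(F̄) ≃ₗ[ℤ_p] TatePt F p W`** under `hss : E[pⁿ](ℂ_F) ⊂ E₁(ℂ_F)` (composition with
  `tateModuleCEquivTatePt`), and **`tateGeomEquivTatePt_galois`: it intertwines `galoisRepTate` with `tatePtRep`** — so the Galois
  representation on `T_pŴ(𝒪_{ℂ_F})`, on which `∫ω` and `HT` are defined, IS the `p`-adic Tate module of `E` restricted to `Γ_F`.

What is NOT here: the discharge of `hss` for K★'s cells (needs the 𝒪_{F'}-model), the passage to `restrictedRationalTateRep W₀ F p` for a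
curve `W₀/ℚ` (tree `TateModuleBaseChange`), `ℚ_p ⊗`. BSD / K★: infrastructure; nothing about elliptic curves over number fields is
proved here.

## References
* J. H. Silverman, *The Arithmetic of Elliptic Curves* (2009), III.§7, Prop. VII.2.2. [SilvermanAEC2009]
* J. Tate, *p-divisible groups* (1967), §4. [Tate1967]
-/

noncomputable section

open scoped Classical NNReal
open Field

namespace Literature.NumberTheory.EllipticCurves.TateModule

variable {A : Type*} [AddCommGroup A] {B : Type*} [AddCommGroup B] (p : ℕ) [Fact p.Prime]

/-- Components of the tree's `TateModule.mapEquiv` (`T_p` of an isomorphism of abelian groups). [cite: SilvermanAEC2009, III.§7] -/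
@[simp] theorem proj_mapEquiv (e : A ≃+ B) (a : TateModule A p) (n : ℕ) : proj p n (mapEquiv p e a) = e (proj p n a) := rfl

end Literature.NumberTheory.EllipticCurves.TateModule

namespace Literature.NumberTheory.PAdicHodge

open Literature.NumberTheory.GaloisRepresentations
open Literature.NumberTheory.GaloisRepresentations.IsNonarchimedeanLocalField
open Literature.NumberTheory.GaloisRepresentations.LubinTate
open Literature.NumberTheory.EllipticCurves Literature.NumberTheory.EllipticCurves.FormalGroupChart

namespace AinfTop

variable {F : Type} [Field F] [ValuativeRel F] [TopologicalSpace F] [IsNonarchimedeanLocalField F] [CharZero F]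
  (W : WeierstrassCurve ℤ) {p : ℕ} [Fact p.Prime]

/-! ## §1 `E(F̄) → E(ℂ_F)` -/

variable (F) in
/-- `E_F = W ⊗ F`. [cite: SilvermanAEC2009, III.§1] -/
abbrev curveF : WeierstrassCurve F := W.map (Int.castRingHom F)

variable (F) in
/-- `E ⊗ F̄` written directly over `F̄`. [cite: SilvermanAEC2009, III.§1] -/
abbrev curveBar : WeierstrassCurve (AlgebraicClosure F) := W.map (Int.castRingHom (AlgebraicClosure F))

omit [ValuativeRel F] [TopologicalSpace F] [IsNonarchimedeanLocalField F] [CharZero F] [Fact p.Prime] in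
/-- `(W ⊗ F) ⊗ F̄ = W ⊗ F̄`. [cite: SilvermanAEC2009, III.§1] -/
theorem curveF_baseChange : (curveF F W).baseChange (AlgebraicClosure F) = curveBar F W := by
  rw [WeierstrassCurve.baseChange, WeierstrassCurve.map_map]
  exact congrArg W.map (RingHom.ext_int _ _)

omit [CharZero F] [Fact p.Prime] in
/-- `(W ⊗ F̄) ⊗_{F̄} ℂ_F = W ⊗ ℂ_F` (`curveOver`). [cite: SilvermanAEC2009, III.§1] -/
theorem curveBar_map_algClosureToC : (curveBar F W).map (algClosureToC F) = curveOver (CompletedAlgClosure F) W := by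
  rw [WeierstrassCurve.map_map, curveOver, ballIntModel, WeierstrassCurve.baseChange, WeierstrassCurve.map_map]
  exact congrArg W.map (RingHom.ext_int _ _)

/-- **`E(F̄) →+ E(ℂ_F)`** along `F̄ → ℂ_F`. [cite: SilvermanAEC2009, III.§7] -/
def geomToC : (curveF F W).geomPoints →+ (curveOver (CompletedAlgClosure F) W).toAffine.Point :=
  (WeierstrassCurve.Affine.Point.congrEquiv (curveBar_map_algClosureToC W)).toAddMonoidHom.comp
    (((curveBar F W).mapPointHom (algClosureToC F)).comp
      (WeierstrassCurve.Affine.Point.congrEquiv (curveF_baseChange W)).toAddMonoidHom)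

omit [CharZero F] [Fact p.Prime] in
/-- `geomToC` on coordinates: `(x, y) ↦ (ι x, ι y)`. [cite: SilvermanAEC2009, III.§7] -/
theorem geomToC_some {x y : AlgebraicClosure F} (h : ((curveF F W).baseChange (AlgebraicClosure F)).toAffine.Nonsingular x y) :
    ∃ h', geomToC W (WeierstrassCurve.Affine.Point.some x y h : (curveF F W).geomPoints) =
      .some (algClosureToC F x) (algClosureToC F y) h' := by
  refine ⟨?_, ?_⟩
  · have h1 : (curveBar F W).toAffine.Nonsingular x y := by rw [← curveF_baseChange W]; exact h
    have h2 : ((curveBar F W).map (algClosureToC F)).toAffine.Nonsingular (algClosureToC F x) (algClosureToC F y) :=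
      (WeierstrassCurve.Affine.map_nonsingular _ (algClosureToC F).injective x y).mpr h1
    rwa [curveBar_map_algClosureToC W] at h2
  · change WeierstrassCurve.Affine.Point.congrEquiv (curveBar_map_algClosureToC W) ((curveBar F W).mapPointHom (algClosureToC F)
      (WeierstrassCurve.Affine.Point.congrEquiv (curveF_baseChange W) (.some x y h))) = _
    rw [WeierstrassCurve.Affine.Point.congrEquiv_some, WeierstrassCurve.mapPointHom_some,
      WeierstrassCurve.Affine.Point.congrEquiv_some]

omit [CharZero F] [Fact p.Prime] in
/-- `geomToC` is injective. [cite: SilvermanAEC2009, III.§7] -/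
theorem geomToC_injective : Function.Injective (geomToC (F := F) W) :=
  (WeierstrassCurve.Affine.Point.congrEquiv (curveBar_map_algClosureToC W)).injective.comp
    ((WeierstrassCurve.mapPointHom_injective _ _).comp (WeierstrassCurve.Affine.Point.congrEquiv (curveF_baseChange W)).injective)

omit [CharZero F] [Fact p.Prime] in
/-- **`geomToC` is `Γ_F`-equivariant**: `ι(σ • P) = σ(ι P)` with the coordinatewise action `galPointC` on `E(ℂ_F)`.
[cite: SilvermanAEC2009, III.§7] -/
theorem geomToC_smul (σ : absoluteGaloisGroup F) (P : (curveF F W).geomPoints) :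
    geomToC W (σ • P) = galPointC W σ (geomToC W P) := by
  set σ' : AlgebraicClosure F ≃ₐ[F] AlgebraicClosure F := σ with hσ'
  rcases P with _ | ⟨x, y, h⟩
  · change geomToC W (σ • (0 : (curveF F W).geomPoints)) = galPointC W σ (geomToC W 0)
    rw [smul_zero, map_zero, map_zero]
  · obtain ⟨h', e⟩ := geomToC_some W h
    change geomToC W (WeierstrassCurve.Affine.Point.map (σ' : AlgebraicClosure F →ₐ[F] AlgebraicClosure F) (.some x y h)) = _
    rw [WeierstrassCurve.Affine.Point.map_some]
    obtain ⟨h'', e'⟩ := geomToC_some W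
      ((WeierstrassCurve.Affine.baseChange_nonsingular (W := curveF F W)
        (f := (σ' : AlgebraicClosure F →ₐ[F] AlgebraicClosure F)) σ'.injective x y).mpr h)
    rw [e', e]
    obtain ⟨h3, e3⟩ := galPointHom_some (W := W) (CompletedAlgClosure.galRingHom σ) (galRingHom_cK σ) h'
    rw [galPointC, e3]
    simp only [WeierstrassCurve.Affine.Point.some.injEq]
    refine ⟨?_, ?_⟩ <;>
    · rw [← CompletedAlgClosure.smul_def, smul_algClosureToC]; rfl

/-! ## §2 The Tate modules -/

omit [ValuativeRel F] [TopologicalSpace F] [IsNonarchimedeanLocalField F] [Fact p.Prime] in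
/-- `W ⊗ F̄` is an elliptic curve when `Δ_W ≠ 0`. [cite: SilvermanAEC2009, III.§1] -/
theorem isElliptic_curveBar (hΔ : W.Δ ≠ 0) : (curveBar F W).IsElliptic := by
  haveI : CharZero (AlgebraicClosure F) := charZero_of_injective_algebraMap (algebraMap F (AlgebraicClosure F)).injective
  exact ⟨by rw [WeierstrassCurve.map_Δ, isUnit_iff_ne_zero, eq_intCast]; exact Int.cast_ne_zero.mpr hΔ⟩

/-- `W ⊗ ℂ_F` is an elliptic curve when `Δ_W ≠ 0`. [cite: SilvermanAEC2009, III.§1] -/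
theorem isElliptic_curveOverC (hΔ : W.Δ ≠ 0) : (curveOver (CompletedAlgClosure F) W).IsElliptic := by
  rw [← curveBar_map_algClosureToC W]
  haveI := isElliptic_curveBar (F := F) W hΔ
  refine ⟨?_⟩
  rw [WeierstrassCurve.map_Δ]
  exact ((curveBar F W).isUnit_Δ).map _

variable (F p) in
/-- **`T_p E(F̄) ≃ₗ[ℤ_p] T_p E(ℂ_F)`** (`p`-power torsion points of `E(ℂ_F)` are algebraic). [cite: SilvermanAEC2009, III.§7] -/
def tateGeomEquivC (hΔ : W.Δ ≠ 0) :
    (curveF F W).tateModule p ≃ₗ[ℤ_[p]] TateModule (curveOver (CompletedAlgClosure F) W).toAffine.Point p :=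
  haveI := isElliptic_curveBar (F := F) W hΔ
  haveI : CharZero (AlgebraicClosure F) := charZero_of_injective_algebraMap (algebraMap F (AlgebraicClosure F)).injective
  (TateModule.mapEquiv p (WeierstrassCurve.Affine.Point.congrEquiv (curveF_baseChange W))).trans
    ((tateModuleMapEquiv (algClosureToC F) (curveBar F W) p (Nat.cast_ne_zero.mpr (Fact.out : p.Prime).ne_zero)).trans
      (TateModule.mapEquiv p (WeierstrassCurve.Affine.Point.congrEquiv (curveBar_map_algClosureToC W))))

/-- Components of `tateGeomEquivC`: `geomToC` on each level. [cite: SilvermanAEC2009, III.§7] -/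
theorem proj_tateGeomEquivC (hΔ : W.Δ ≠ 0) (τ : (curveF F W).tateModule p) (n : ℕ) :
    TateModule.proj p n (tateGeomEquivC F W p hΔ τ) = geomToC W (TateModule.proj p n τ) := by
  simp only [tateGeomEquivC, LinearEquiv.trans_apply, TateModule.proj_mapEquiv, proj_tateModuleMapEquiv]
  rfl

/-- `tateGeomEquivC (σ • τ) = T_p(σ) (tateGeomEquivC τ)`. [cite: SilvermanAEC2009, III.§7] -/
theorem tateGeomEquivC_smul (hΔ : W.Δ ≠ 0) (σ : absoluteGaloisGroup F) (τ : (curveF F W).tateModule p) :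
    tateGeomEquivC F W p hΔ (σ • τ) = TateModule.map p (galPointC W σ) (tateGeomEquivC F W p hΔ τ) :=
  TateModule.ext fun n => by
    rw [proj_tateGeomEquivC, TateModule.proj_map, proj_tateGeomEquivC, TateModule.proj_smul_of_distribMulAction]
    exact geomToC_smul W σ _

variable (F p) in
/-- **`T_p E(F̄) ≃ₗ[ℤ_p] T_pŴ(𝒪_{ℂ_F}) = TatePt F p W`** when every `p`-power torsion point of `E(ℂ_F)` lies in `E₁(ℂ_F)`: the
geometric Tate module is the Tate module of the formal group. [cite: SilvermanAEC2009, Prop. VII.2.2] [cite: Tate1967, §4] -/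
def tateGeomEquivTatePt (hΔ : W.Δ ≠ 0)
    (hss : ∀ (n : ℕ) (P : (curveOver (CompletedAlgClosure F) W).toAffine.Point), p ^ n • P = 0 →
      P ∈ @kernel _ _ (NormedField.valuation (K := CompletedAlgClosure F)) (curveOver (CompletedAlgClosure F) W)
        (isIntegral_curveOver _ _)) :
    (curveF F W).tateModule p ≃ₗ[ℤ_[p]] TatePt F p W :=
  haveI := isElliptic_curveOverC (F := F) W hΔ
  (tateGeomEquivC F W p hΔ).trans (tateModuleCEquivTatePt F W p hss)

/-- **`Γ_F`-equivariance of the matching `T_p E(F̄) ≅ T_pŴ(𝒪_{ℂ_F})`**: `galoisRepTate σ` on the left is `tatePtRep σ` on the right.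
[cite: SilvermanAEC2009, III.§7] [cite: Tate1967, §4] -/
theorem tateGeomEquivTatePt_galois (hΔ : W.Δ ≠ 0)
    (hss : ∀ (n : ℕ) (P : (curveOver (CompletedAlgClosure F) W).toAffine.Point), p ^ n • P = 0 →
      P ∈ @kernel _ _ (NormedField.valuation (K := CompletedAlgClosure F)) (curveOver (CompletedAlgClosure F) W)
        (isIntegral_curveOver _ _))
    (σ : absoluteGaloisGroup F) (τ : (curveF F W).tateModule p) :
    tateGeomEquivTatePt F W p hΔ hss ((curveF F W).galoisRepTate p σ τ) = tatePtRep F p W σ (tateGeomEquivTatePt F W p hΔ hss τ) := by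
  haveI := isElliptic_curveOverC (F := F) W hΔ
  rw [WeierstrassCurve.galoisRepTate_apply_apply, tatePtRep_apply_apply]
  change tateModuleCEquivTatePt F W p hss (tateGeomEquivC F W p hΔ (σ • τ)) = σ • tateModuleCEquivTatePt F W p hss (tateGeomEquivC F W p hΔ τ)
  rw [tateGeomEquivC_smul, tateModuleCEquivTatePt_galois]

end AinfTop

end Literature.NumberTheory.PAdicHodge

end
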